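import Mathlib

/-!
# The reduced Kleitman inequality (N), I: abstract spaces and tensorization

For a finite preordered type `X` with maps `c r : X → X` ("complement" and "reduction") and a
class `Valid` of finsets, the space satisfies **(N)** if for every upper family `U` and every
valid `W`

  `#(U ∩ W) ≤ #{x ∈ U | c x ∈ W ∧ r x ∈ U}`.

On the cube `Π_t 2^{Z_t} × 2^{E'}` of a bundle (threads `Z_t`, free coordinates `E'`), with `c`
the complementation map, `r` = "remove the first edge of every fully red thread" and `Valid` =
"decreasing, no thread-full point, red→dark twin-closed", (N) is the Hall condition of the
one-type matching with the NAM discipline ("a target full on a thread is used only by sources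
dark at its first edge"), sharpening Kleitman's `#(U ∩ W) ≤ #(U ∩ c(W))`.

This file proves that (N) **tensorizes** (`isNSpace_prod`; validity on a product is fibrewise
validity), the `ρ`-rearrangement used by the thread step, and (N) for a free coordinate and for
the one-point space.  Part II (`…ReducedKleitmanThread`) does the single thread by induction on
its length and assembles arbitrary bundles.
-/

namespace Summit.CriticalPhenomena.PercolationContinuityZ3.Theorems.Coefficientwise.ReducedKleitman

open Finset

variable {X Y : Type*}

section Defs

variable [DecidableEq X]

/-- The admissible targets `ρ(U,W) = {x ∈ U | c x ∈ W ∧ r x ∈ U}`. -/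
def rho (c r : X → X) (U W : Finset X) : Finset X :=
  U.filter (fun x => c x ∈ W ∧ r x ∈ U)

/-- Membership in `rho`. -/
theorem mem_rho {c r : X → X} {U W : Finset X} {x : X} :
    x ∈ rho c r U W ↔ x ∈ U ∧ c x ∈ W ∧ r x ∈ U := by
  simp [rho]

variable [Fintype X] [Preorder X]

/-- The reduced Kleitman property (N) of the space `(X, c, r, Valid)`. -/
def IsNSpace (c r : X → X) (Valid : Finset X → Prop) : Prop :=
  ∀ U W : Finset X, IsUpperSet (U : Set X) → Valid W → (U ∩ W).card ≤ (rho c r U W).card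

end Defs

section Fibres

variable [Fintype X] [DecidableEq X] [Fintype Y] [DecidableEq Y]

/-- The fibre of `S ⊆ X × Y` over `x : X`, as a finset of `Y`. -/
def fibL (S : Finset (X × Y)) (x : X) : Finset Y := univ.filter (fun y => (x, y) ∈ S)

/-- The fibre of `S ⊆ X × Y` over `y : Y`, as a finset of `X`. -/
def fibR (S : Finset (X × Y)) (y : Y) : Finset X := univ.filter (fun x => (x, y) ∈ S)

omit [Fintype X] in
/-- Membership in a left fibre. -/
@[simp] theorem mem_fibL {S : Finset (X × Y)} {x : X} {y : Y} :
    y ∈ fibL S x ↔ (x, y) ∈ S := by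
  simp [fibL]

omit [Fintype Y] in
/-- Membership in a right fibre. -/
@[simp] theorem mem_fibR {S : Finset (X × Y)} {x : X} {y : Y} :
    x ∈ fibR S y ↔ (x, y) ∈ S := by
  simp [fibR]

/-- Cardinality of a finset of pairs as the sum of its left fibres. -/
theorem card_eq_sum_card_fibL (S : Finset (X × Y)) : S.card = ∑ x, (fibL S x).card := by
  rw [card_eq_sum_card_fiberwise (f := Prod.fst) (s := S) (t := univ) (fun _ _ => mem_univ _)]
  refine sum_congr rfl (fun x _ => ?_)
  rw [show S.filter (fun p => p.1 = x) = (fibL S x).map (Function.Embedding.sectR x Y) from ?_]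
  · exact card_map _
  · ext ⟨a, b⟩
    constructor
    · intro h
      rw [mem_filter] at h
      obtain ⟨hS, rfl⟩ := h
      exact mem_map.2 ⟨b, mem_fibL.2 hS, rfl⟩
    · intro h
      obtain ⟨b', hb', hab⟩ := mem_map.1 h
      rw [Function.Embedding.sectR_apply] at hab
      obtain ⟨rfl, rfl⟩ := Prod.mk.inj hab
      exact mem_filter.2 ⟨mem_fibL.1 hb', rfl⟩

/-- Cardinality of a finset of pairs as the sum of its right fibres. -/
theorem card_eq_sum_card_fibR (S : Finset (X × Y)) : S.card = ∑ y, (fibR S y).card := by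
  rw [card_eq_sum_card_fiberwise (f := Prod.snd) (s := S) (t := univ) (fun _ _ => mem_univ _)]
  refine sum_congr rfl (fun y _ => ?_)
  rw [show S.filter (fun p => p.2 = y) = (fibR S y).map (Function.Embedding.sectL X y) from ?_]
  · exact card_map _
  · ext ⟨a, b⟩
    constructor
    · intro h
      rw [mem_filter] at h
      obtain ⟨hS, rfl⟩ := h
      exact mem_map.2 ⟨a, mem_fibR.2 hS, rfl⟩
    · intro h
      obtain ⟨a', ha', hab⟩ := mem_map.1 h
      rw [Function.Embedding.sectL_apply] at hab
      obtain ⟨rfl, rfl⟩ := Prod.mk.inj hab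
      exact mem_filter.2 ⟨mem_fibR.1 ha', rfl⟩

end Fibres

section Sums

variable [Fintype X] [DecidableEq X]

/-- A finset's cardinality as a sum of indicators over the whole type. -/
theorem card_eq_sum_ite (S : Finset X) : S.card = ∑ x, if x ∈ S then 1 else 0 := by
  rw [Finset.sum_boole]
  congr 1; ext x; simp

/-- Cardinality of a filter as a sum of indicators over the whole type. -/
theorem card_filter_eq_sum_ite (S : Finset X) (p : X → Prop) [DecidablePred p] :
    (S.filter p).card = ∑ x, if x ∈ S ∧ p x then 1 else 0 := by
  rw [Finset.sum_boole]
  congr 1; ext x; simp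

/-- The cardinality of `rho` as a sum of indicators. -/
theorem card_rho_eq_sum (c r : X → X) (U W : Finset X) :
    (rho c r U W).card = ∑ x, if (x ∈ U ∧ r x ∈ U) ∧ c x ∈ W then 1 else 0 := by
  rw [Finset.sum_boole]
  congr 1; ext x; rw [mem_rho, mem_filter]; simp only [mem_univ, true_and]; tauto

/-- The elementary rearrangement `[a₀b₀] + [a₁b₁] ≤ [a₀b₁] + [a₁b₀]` for `a₀ → a₁`,
`b₁ → b₀`. -/
theorem ite_rearrangement (a₀ a₁ b₀ b₁ : Prop) [Decidable a₀] [Decidable a₁]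
    [Decidable b₀] [Decidable b₁] (ha : a₀ → a₁) (hb : b₁ → b₀) :
    (if a₀ ∧ b₀ then 1 else 0) + (if a₁ ∧ b₁ then 1 else 0) ≤
      (if a₀ ∧ b₁ then 1 else 0) + (if a₁ ∧ b₀ then (1 : ℕ) else 0) := by
  by_cases h₀ : a₀ <;> by_cases h₁ : a₁ <;> by_cases k₀ : b₀ <;> by_cases k₁ : b₁ <;>
    simp_all

/-- **ρ-rearrangement.** For `U₀ ⊆ U₁` and `W₁ ⊆ W₀`:
`#ρ(U₀,W₀) + #ρ(U₁,W₁) ≤ #ρ(U₀,W₁) + #ρ(U₁,W₀)`. -/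
theorem rho_rearrangement (c r : X → X) {U₀ U₁ W₀ W₁ : Finset X} (hU : U₀ ⊆ U₁)
    (hW : W₁ ⊆ W₀) :
    (rho c r U₀ W₀).card + (rho c r U₁ W₁).card ≤
      (rho c r U₀ W₁).card + (rho c r U₁ W₀).card := by
  rw [card_rho_eq_sum, card_rho_eq_sum, card_rho_eq_sum, card_rho_eq_sum, ← sum_add_distrib,
    ← sum_add_distrib]
  refine sum_le_sum (fun x _ => ?_)
  exact ite_rearrangement _ _ _ _ (fun h => ⟨hU h.1, hU h.2⟩) (fun h => hW h)

end Sums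

section Prod

variable [Fintype X] [DecidableEq X] [Preorder X] [Fintype Y] [DecidableEq Y] [Preorder Y]

/-- Fibrewise validity on a product. -/
def ProdValid (VX : Finset X → Prop) (VY : Finset Y → Prop) (W : Finset (X × Y)) : Prop :=
  (∀ x, VY (fibL W x)) ∧ (∀ y, VX (fibR W y))

/-- **Tensorization of (N).** If `X` and `Y` satisfy (N) and `r_Y y ≤ y`, then `X × Y` with the
product order, `c = (c_X, c_Y)`, `r = (r_X, r_Y)` and fibrewise validity satisfies (N). -/
theorem isNSpace_prod {cX rX : X → X} {cY rY : Y → Y} {VX : Finset X → Prop}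
    {VY : Finset Y → Prop}
    (hrY : ∀ y, rY y ≤ y) (hX : IsNSpace cX rX VX) (hY : IsNSpace cY rY VY) :
    IsNSpace (Prod.map cX cY) (Prod.map rX rY) (ProdValid VX VY) := by
  intro U W hU hW
  -- T₁ = {(x,y) | (x, r y) ∈ U ∧ (x, c y) ∈ W},
  -- T₂ = {(x,y) ∈ T₁ | (c x, c y) ∈ W ∧ (r x, r y) ∈ U}
  set T₁ : Finset (X × Y) :=
    univ.filter (fun p => (p.1, rY p.2) ∈ U ∧ (p.1, cY p.2) ∈ W) with hT₁
  set T₂ : Finset (X × Y) :=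
    univ.filter (fun p => (p.1, rY p.2) ∈ U ∧ (cX p.1, cY p.2) ∈ W ∧ (rX p.1, rY p.2) ∈ U)
    with hT₂
  have hUmono : ∀ x y y', y ≤ y' → (x, y) ∈ U → (x, y') ∈ U := fun x y y' h hm =>
    hU (show (x, y) ≤ (x, y') from Prod.mk_le_mk.2 ⟨le_rfl, h⟩) hm
  -- step 1: fibrewise (N) on Y
  have h1 : (U ∩ W).card ≤ T₁.card := by
    rw [card_eq_sum_card_fibL (U ∩ W), card_eq_sum_card_fibL T₁]
    refine sum_le_sum (fun x _ => ?_)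
    have hup : IsUpperSet (fibL U x : Set Y) := by
      intro y y' hyy' hy
      rw [mem_coe, mem_fibL] at hy ⊢
      exact hUmono x y y' hyy' hy
    have h := hY (fibL U x) (fibL W x) hup (hW.1 x)
    have e1 : fibL (U ∩ W) x = fibL U x ∩ fibL W x := by
      ext y; simp [mem_fibL, mem_inter]
    have e2 : rho cY rY (fibL U x) (fibL W x) = fibL T₁ x := by
      ext y
      rw [mem_rho, mem_fibL, mem_fibL, mem_fibL, mem_fibL, hT₁, mem_filter]
      constructor
      · rintro ⟨_, hc, hr⟩; exact ⟨mem_univ _, hr, hc⟩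
      · rintro ⟨_, hr, hc⟩; exact ⟨hUmono x _ _ (hrY y) hr, hc, hr⟩
    rw [e1, ← e2]; exact h
  -- step 2: fibrewise (N) on X
  have h2 : T₁.card ≤ T₂.card := by
    rw [card_eq_sum_card_fibR T₁, card_eq_sum_card_fibR T₂]
    refine sum_le_sum (fun y _ => ?_)
    have hup : IsUpperSet (fibR U (rY y) : Set X) := by
      intro x x' hxx' hx
      rw [mem_coe, mem_fibR] at hx ⊢
      exact hU (show (x, rY y) ≤ (x', rY y) from Prod.mk_le_mk.2 ⟨hxx', le_rfl⟩) hx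
    have h := hX (fibR U (rY y)) (fibR W (cY y)) hup (hW.2 (cY y))
    have e1 : fibR T₁ y = fibR U (rY y) ∩ fibR W (cY y) := by
      ext x; simp [mem_fibR, hT₁]
    have e2 : rho cX rX (fibR U (rY y)) (fibR W (cY y)) = fibR T₂ y := by
      ext x
      rw [mem_rho, mem_fibR, mem_fibR, mem_fibR, mem_fibR, hT₂, mem_filter]
      constructor
      · rintro ⟨hu, hc, hr⟩; exact ⟨mem_univ _, hu, hc, hr⟩
      · rintro ⟨_, hu, hc, hr⟩; exact ⟨hu, hc, hr⟩
    rw [e1, ← e2]; exact h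
  -- step 3: T₂ ⊆ ρ(U, W)
  have h3 : T₂.card ≤ (rho (Prod.map cX cY) (Prod.map rX rY) U W).card := by
    refine card_le_card (fun p hp => ?_)
    rw [hT₂, mem_filter] at hp
    obtain ⟨_, hu, hc, hr⟩ := hp
    rw [mem_rho]
    exact ⟨hUmono p.1 _ _ (hrY p.2) hu, hc, hr⟩
  exact h1.trans (h2.trans h3)

end Prod

section Bases

/-- The top of `Bool` is `true`. -/
theorem bool_top : (⊤ : Bool) = true := rfl

/-- The bottom of `Bool` is `false`. -/
theorem bool_bot : (⊥ : Bool) = false := rfl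

/-- An upper family of `Bool` is `∅`, `{true}` or everything. -/
theorem upper_bool_cases (U : Finset Bool) (hU : IsUpperSet (U : Set Bool)) :
    U = ∅ ∨ U = {true} ∨ U = univ := by
  by_cases ht : true ∈ U
  · by_cases hf : false ∈ U
    · right; right; ext b; cases b <;> simp [ht, hf]
    · right; left; ext b; cases b <;> simp [ht, hf]
  · have hf : false ∉ U := fun hf => ht (hU (show false ≤ true by decide) hf)
    left; ext b; cases b <;> simp [ht, hf]

/-- A lower family of `Bool` is `∅`, `{false}` or everything. -/
theorem lower_bool_cases (W : Finset Bool) (hW : IsLowerSet (W : Set Bool)) :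
    W = ∅ ∨ W = {false} ∨ W = univ := by
  by_cases hf : false ∈ W
  · by_cases ht : true ∈ W
    · right; right; ext b; cases b <;> simp [ht, hf]
    · right; left; ext b; cases b <;> simp [ht, hf]
  · have ht : true ∉ W := fun ht => hf (hW (show false ≤ true by decide) ht)
    left; ext b; cases b <;> simp [ht, hf]

/-- **(N) for a free coordinate** (`c = not`, `r = id`, every lower family valid). -/
theorem isNSpace_free :
    IsNSpace (X := Bool) (fun b => !b) id (fun W => IsLowerSet (W : Set Bool)) := by
  intro U W hU hW
  rcases upper_bool_cases U hU with hU' | hU' | hU' <;>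
    rcases lower_bool_cases W hW with hW' | hW' | hW' <;> subst hU' hW' <;> decide

/-- **(N) for the one-point space** (no coordinates at all). -/
theorem isNSpace_unit : IsNSpace (X := Unit) id id (fun _ => True) := by
  intro U W _ _
  refine card_le_card (fun x hx => ?_)
  rw [mem_rho]
  exact ⟨(mem_inter.1 hx).1, by
    have : W = U := by
      ext y; constructor <;> intro _
      · exact (mem_inter.1 hx).1
      · exact (mem_inter.1 hx).2
    rw [this]; exact (mem_inter.1 hx).1, (mem_inter.1 hx).1⟩

end Bases

end Summit.CriticalPhenomena.PercolationContinuityZ3.Theorems.Coefficientwise.ReducedKleitman
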